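import Mathlib
import HarnessLib
import Summits.HubbardSuperconductivity.HubbardSuperconductivity.Theorems.KLProgrammeKLRegimeFatMultiplierIncrementSampled
import Summits.HubbardSuperconductivity.HubbardSuperconductivity.Theorems.KLProgrammeKLRegimeFatMultiplierIncrementTimeLine

/-!
# Route `KLProgramme` — crux K3 ENGINE (stmt-…-20437) stub (b) conj. 2 «(c-D)² FAMILY TELESCOPE» / VL (stmt-…-20440) M2 (c2): the SAMPLED INCREMENT SYMBOL
# `Φ(k₀,p) = [Gₙ(k₀²+(e−ν)²) − Gₙ(k₀²+e²)]·Q(k₀,p)` — TIME differences of orders `1, 2, 3` (brick (D2b), generic layer, Matsubara direction)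

Cell `gate-hubbard-kl`, seat hubbard-kl-k3c3-p2 (g10); companion of `…FatMultiplierIncrementSampled` (space directions).  Along the time line
`s ↦ (k₀ + s h₀, p)` the bands are constant and the increment is the one of `…FatMultiplierIncrementTimeLine` (`D₁ = 2Λ|h₀|`, `D₂ = 2h₀²`, `W₀ = P₀(2E₀+P₀)`,
`E₀ = Λ + P₀`; localisation `|k₀ + s h₀| ≤ Λ`, and `Φ ≡ 0` on the whole time line when `|e(p)| > Λ + P₀`); the co-factor `Q` may depend on `k₀` (for the pair
term of (F1) it contains the second radial factor `Gₙ(k₀²+e²)`), so its time-line derivatives `qt₁, qt₂, qt₃` enter, localised to the time shell.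

* **`norm_fwdDiff_iter_time_incrSymbol_le`** — with the frequency window `Λ < |a₀ + h₀m|` for `m < 3` and `m ≥ P − 3` (`symbol_window₃`):
  `‖Δ_{(1,0)} Gs‖ ≤ 𝔅ᵗ₁q₀ + 𝔅ᵗ₀qt₁`, `‖Δ²_{(1,0)} Gs‖ ≤ 𝔅ᵗ₂q₀ + 2𝔅ᵗ₁qt₁ + 𝔅ᵗ₀qt₂`, `‖Δ³_{(1,0)} Gs‖ ≤ 𝔅ᵗ₃q₀ + 3𝔅ᵗ₂qt₁ + 3𝔅ᵗ₁qt₂ + 𝔅ᵗ₀qt₃`,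
  `𝔅ᵗ₀ = C₁W₀`, `𝔅ᵗ₁ = C₂W₀D₁`, `𝔅ᵗ₂ = C₃W₀D₁² + C₂W₀D₂`, `𝔅ᵗ₃ = C₄W₀D₁³ + 3C₃W₀D₁D₂` — every monomial carries `P₀`.

Everything is proved; no definitions, no sorry.  Nothing asserts superconductivity. [cite: BenfattoGiulianiMastropietro2006, §2.5 Lemma 2.2 (2.53)–(2.55), §3 (3.2)–(3.8)]
-/

noncomputable section

namespace Summit.HubbardSuperconductivity.HubbardSuperconductivity.Theorems.TorusFourierL2

set_option linter.dupNamespace false -- summit = problem name (single-conjunct summit), D-0017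

open Set Finset Filter Topology Literature.MathematicalPhysics.QuantumLattice Literature.MathematicalPhysics.QuantumLattice.FermiRG
open Literature.Probability.LatticeModels Literature.Analysis.Calculus
open Summit.HubbardSuperconductivity.HubbardSuperconductivity.Theorems.KLRegimeSplit
open Summit.HubbardSuperconductivity.HubbardSuperconductivity.Theorems.KLProgrammeLegKernels
open scoped Real

section SampledTime

variable {P L : ℕ} [NeZero P] [NeZero L]

set_option maxHeartbeats 1600000 in
/-- **Time differences of the sampled increment symbol** (see the module docstring). [cite: BenfattoGiulianiMastropietro2006, §2.5 Lemma 2.2 (2.53)–(2.55)] -/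
theorem norm_fwdDiff_iter_time_incrSymbol_le {e₀ : ℝ} (he : 0 < e₀) (n : ℕ) {d : ℝ} (hd1 : ∀ u, |deriv (bgmCutoffSq e₀) u| ≤ d)
    (hd2 : ∀ u, |iteratedDeriv 2 (bgmCutoffSq e₀) u| ≤ d) (hd3 : ∀ u, |iteratedDeriv 3 (bgmCutoffSq e₀) u| ≤ d)
    (hd4 : ∀ u, |iteratedDeriv 4 (bgmCutoffSq e₀) u| ≤ d)
    (e ν : (Fin 2 → ℝ) → ℝ) {P₀ : ℝ} (hP₀ : ∀ p, |ν p| ≤ P₀) (h₀ : ℝ)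
    -- the co-factor along the time lines
    (Q : ℝ × (Fin 2 → ℝ) → ℝ) (hQ : ∀ (k₀ : ℝ) (p : Fin 2 → ℝ), ContDiff ℝ 3 (fun s : ℝ => Q (k₀ + s * h₀, p)))
    {q₀ qt₁ qt₂ qt₃ : ℝ} (hq₀0 : 0 ≤ q₀) (hq₁0 : 0 ≤ qt₁) (hq₂0 : 0 ≤ qt₂) (hq₃0 : 0 ≤ qt₃) (hq₀ : ∀ k₀ p, |Q (k₀, p)| ≤ q₀)
    (hq₁ : ∀ (k₀ : ℝ) (p : Fin 2 → ℝ) (s : ℝ), (∀ i, |p i| ≤ π) → |e p| ≤ klScale e₀ n + P₀ → |k₀ + s * h₀| ≤ klScale e₀ n →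
      |deriv (fun s : ℝ => Q (k₀ + s * h₀, p)) s| ≤ qt₁)
    (hq₂ : ∀ (k₀ : ℝ) (p : Fin 2 → ℝ) (s : ℝ), (∀ i, |p i| ≤ π) → |e p| ≤ klScale e₀ n + P₀ → |k₀ + s * h₀| ≤ klScale e₀ n →
      |iteratedDeriv 2 (fun s : ℝ => Q (k₀ + s * h₀, p)) s| ≤ qt₂)
    (hq₃ : ∀ (k₀ : ℝ) (p : Fin 2 → ℝ) (s : ℝ), (∀ i, |p i| ≤ π) → |e p| ≤ klScale e₀ n + P₀ → |k₀ + s * h₀| ≤ klScale e₀ n →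
      |iteratedDeriv 3 (fun s : ℝ => Q (k₀ + s * h₀, p)) s| ≤ qt₃)
    -- the symbol and its samples
    (Φ : ℝ × (Fin 2 → ℝ) → ℂ)
    (hΦ : ∀ k₀ p, Φ (k₀, p) = (((bgmCutoffSq e₀ ((16 : ℝ) ^ n * (k₀ ^ 2 + (e p - ν p) ^ 2)) -
      bgmCutoffSq e₀ ((16 : ℝ) ^ n * (k₀ ^ 2 + e p ^ 2))) * Q (k₀, p) : ℝ) : ℂ))
    (a₀ hx : ℝ) (hwin : ∀ m : ℤ, (m < 3 ∨ (P : ℤ) ≤ m + 3) → klScale e₀ n < |a₀ + h₀ * (m : ℝ)|) (hxL : |hx| * L = 2 * π)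
    (Gs : TorusSite 1 P × TorusSite 2 L → ℂ)
    (hGs : ∀ q, Gs q = Φ (a₀ + h₀ * (((q.1 0).val : ℕ) : ℝ), fun j => hx * (((q.2 j).valMinAbs : ℤ) : ℝ)))
    -- the constants (instantiate with `rfl`)
    {E₀ C₁ C₂ C₃ C₄ D₁ D₂ W₀ B₀ B₁ B₂ B₃ : ℝ} (hE₀ : E₀ = klScale e₀ n + P₀)
    (hC₁ : C₁ = d * e₀ ^ 2 / klScale e₀ n ^ 2) (hC₂ : C₂ = d * e₀ ^ 4 / klScale e₀ n ^ 4) (hC₃ : C₃ = d * e₀ ^ 6 / klScale e₀ n ^ 6)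
    (hC₄ : C₄ = d * e₀ ^ 8 / klScale e₀ n ^ 8) (hD₁ : D₁ = 2 * klScale e₀ n * |h₀|) (hD₂ : D₂ = 2 * h₀ ^ 2) (hW₀ : W₀ = P₀ * (2 * E₀ + P₀))
    (hB₀ : B₀ = C₁ * W₀) (hB₁ : B₁ = C₂ * W₀ * D₁) (hB₂ : B₂ = C₃ * W₀ * D₁ ^ 2 + C₂ * W₀ * D₂)
    (hB₃ : B₃ = C₄ * W₀ * D₁ ^ 3 + 3 * (C₃ * W₀ * (D₁ * D₂)))
    (q : TorusSite 1 P × TorusSite 2 L) :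
    ‖(fwdDiff ((fun _ : Fin 1 => (1 : ZMod P)), (0 : TorusSite 2 L))) Gs q‖ ≤ B₁ * q₀ + B₀ * qt₁ ∧
    ‖((fwdDiff ((fun _ : Fin 1 => (1 : ZMod P)), (0 : TorusSite 2 L)))^[2] Gs) q‖ ≤ B₂ * q₀ + 2 * (B₁ * qt₁) + B₀ * qt₂ ∧
    ‖((fwdDiff ((fun _ : Fin 1 => (1 : ZMod P)), (0 : TorusSite 2 L)))^[3] Gs) q‖ ≤ B₃ * q₀ + 3 * (B₂ * qt₁) + 3 * (B₁ * qt₂) + B₀ * qt₃ := by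
  have hΛ : 0 < klScale e₀ n := by rw [klScale]; positivity
  have hd0 : 0 ≤ d := (abs_nonneg _).trans (hd1 0)
  have hP0 : 0 ≤ P₀ := (abs_nonneg _).trans (hP₀ 0)
  have hE0 : 0 ≤ E₀ := by rw [hE₀]; positivity
  have c1 : 0 ≤ C₁ := by rw [hC₁]; positivity
  have c2 : 0 ≤ C₂ := by rw [hC₂]; positivity
  have c3 : 0 ≤ C₃ := by rw [hC₃]; positivity
  have c4 : 0 ≤ C₄ := by rw [hC₄]; positivity
  have d1 : 0 ≤ D₁ := by rw [hD₁]; positivity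
  have d2 : 0 ≤ D₂ := by rw [hD₂]; positivity
  have w0 : 0 ≤ W₀ := by rw [hW₀]; positivity
  have hB0 : 0 ≤ B₀ := by rw [hB₀]; positivity
  have hB1 : 0 ≤ B₁ := by rw [hB₁]; positivity
  have hB2 : 0 ≤ B₂ := by rw [hB₂]; positivity
  have hB3 : 0 ≤ B₃ := by rw [hB₃]; positivity
  -- the frequency window: `Φ(a₀ + h₀ m, ·) = 0` for `m < N` or `m ≥ P − N`, `N ≤ 3`
  set G : ℝ → ℝ := fun u => bgmCutoffSq e₀ ((16 : ℝ) ^ n * u) with hGdef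
  have hsupp : ∀ (N : ℕ), N ≤ 3 → ∀ (m : ℤ) (k : Fin 2 → ℝ), (m < (N : ℤ) ∨ (P : ℤ) ≤ m + N) → Φ (a₀ + h₀ * (m : ℝ), k) = 0 := by
    intro N hN m k hm
    have hm' : m < 3 ∨ (P : ℤ) ≤ m + 3 := by
      rcases hm with hm | hm
      · left; have : (N : ℤ) ≤ 3 := by exact_mod_cast hN
        omega
      · right; have : (N : ℤ) ≤ 3 := by exact_mod_cast hN
        omega
    have hlt := hwin m hm'
    have h1 : klScale e₀ n ^ 2 < (a₀ + h₀ * (m : ℝ)) ^ 2 := by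
      have := sq_lt_sq' (by linarith [abs_nonneg (a₀ + h₀ * (m : ℝ))]) hlt
      rw [sq_abs] at this; exact this
    have z1 : G ((a₀ + h₀ * (m : ℝ)) ^ 2 + (e k - ν k) ^ 2) = 0 := by
      have h := scaleProfile_iteratedDeriv_eq_zero he n 0 (u := (a₀ + h₀ * (m : ℝ)) ^ 2 + (e k - ν k) ^ 2) (by nlinarith [sq_nonneg (e k - ν k)])
      rwa [iteratedDeriv_zero] at h
    have z2 : G ((a₀ + h₀ * (m : ℝ)) ^ 2 + e k ^ 2) = 0 := by
      have h := scaleProfile_iteratedDeriv_eq_zero he n 0 (u := (a₀ + h₀ * (m : ℝ)) ^ 2 + e k ^ 2) (by nlinarith [sq_nonneg (e k)])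
      rwa [iteratedDeriv_zero] at h
    rw [hΦ]
    simp only [hGdef] at z1 z2
    rw [z1, z2]; simp
  -- the sample point and the time line
  set k₀ : ℝ := a₀ + h₀ * (((q.1 0).val : ℕ) : ℝ) with hk₀
  set k : Fin 2 → ℝ := fun j => hx * (((q.2 j).valMinAbs : ℤ) : ℝ) with hk
  have hksq : ∀ i, |k i| ≤ π := fun i => abs_sample_le_pi hxL q.2 i
  set Ir : ℝ → ℝ := fun s => G ((k₀ + s * h₀) ^ 2 + (e k - ν k) ^ 2) - G ((k₀ + s * h₀) ^ 2 + e k ^ 2) with hIr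
  set Ql : ℝ → ℝ := fun s => Q (k₀ + s * h₀, k) with hQl
  have hGC : ContDiff ℝ 3 G := (contDiff_bgmCutoffSq he).comp (contDiff_const.mul contDiff_id)
  have hlinC : ContDiff ℝ 3 (fun s : ℝ => k₀ + s * h₀) := contDiff_const.add (contDiff_id.mul contDiff_const)
  have hIrC : ContDiff ℝ 3 Ir :=
    (hGC.comp ((hlinC.pow 2).add contDiff_const)).sub (hGC.comp ((hlinC.pow 2).add contDiff_const))
  have hQlC : ContDiff ℝ 3 Ql := hQ k₀ k
  have hline : (fun s : ℝ => Φ (((k₀, k) : ℝ × (Fin 2 → ℝ)) + s • ((h₀, 0) : ℝ × (Fin 2 → ℝ)))) = fun s => (((Ir s * Ql s : ℝ)) : ℂ) := by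
    funext s; rw [timeLine_apply, hΦ]
  have hreal : ContDiff ℝ 3 fun s : ℝ => Ir s * Ql s := hIrC.mul hQlC
  have hC : ContDiff ℝ 3 fun s : ℝ => Φ (((k₀, k) : ℝ × (Fin 2 → ℝ)) + s • ((h₀, 0) : ℝ × (Fin 2 → ℝ))) := by
    rw [hline]; exact Complex.ofRealCLM.contDiff.comp hreal
  -- pointwise Leibniz bound along the time line (two cases on the spatial shell)
  have hmain : ∀ s, |iteratedDeriv 1 (fun s => Ir s * Ql s) s| ≤ B₁ * q₀ + B₀ * qt₁ ∧
      |iteratedDeriv 2 (fun s => Ir s * Ql s) s| ≤ B₂ * q₀ + 2 * (B₁ * qt₁) + B₀ * qt₂ ∧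
      |iteratedDeriv 3 (fun s => Ir s * Ql s) s| ≤ B₃ * q₀ + 3 * (B₂ * qt₁) + 3 * (B₁ * qt₂) + B₀ * qt₃ := by
    intro s
    by_cases hek : |e k| ≤ klScale e₀ n + P₀
    · -- near: the time-line chain of the increment
      obtain ⟨I₁, I₂, I₃, c0, c1, c2, b0, b1, b2, b3⟩ := profileIncr_time_hasDerivAt_chain_bounds he n hd1 hd2 hd3 hd4 k₀ h₀ (e k) (ν k)
        hek (hP₀ k) (W₀ := W₀) hC₁ hC₂ hC₃ hC₄ hD₁ hD₂ (by rw [hW₀, hE₀])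
      have hIc : (fun s => ((bgmCutoffSq e₀ ((16 : ℝ) ^ n * ((k₀ + s * h₀) ^ 2 + (e k - ν k) ^ 2)) : ℝ) : ℂ) -
          ((bgmCutoffSq e₀ ((16 : ℝ) ^ n * ((k₀ + s * h₀) ^ 2 + e k ^ 2)) : ℝ) : ℂ)) = fun s => ((Ir s : ℝ) : ℂ) := by
        funext s; simp only [hIr, hGdef]; push_cast; ring
      rw [hIc] at c0
      obtain ⟨d1', d2', d3'⟩ := iteratedDeriv_eq_of_hasDerivAt_chain₃ c0 c1 c2
      have rI0 : ∀ s, |Ir s| ≤ B₀ := fun s => by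
        have h := b0 s
        have e1 : ((bgmCutoffSq e₀ ((16 : ℝ) ^ n * ((k₀ + s * h₀) ^ 2 + (e k - ν k) ^ 2)) : ℝ) : ℂ) -
            ((bgmCutoffSq e₀ ((16 : ℝ) ^ n * ((k₀ + s * h₀) ^ 2 + e k ^ 2)) : ℝ) : ℂ) = ((Ir s : ℝ) : ℂ) := by
          simp only [hIr, hGdef]; push_cast; ring
        rw [e1, Complex.norm_real, Real.norm_eq_abs, ← hB₀] at h; exact h
      have rI1 : ∀ s, |iteratedDeriv 1 Ir s| ≤ B₁ := fun s => by
        rw [← norm_iteratedDeriv_ofReal_comp (hIrC.of_le (by norm_num)) s, d1', hB₁]; exact b1 s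
      have rI2 : ∀ s, |iteratedDeriv 2 Ir s| ≤ B₂ := fun s => by
        rw [← norm_iteratedDeriv_ofReal_comp (hIrC.of_le (by norm_num)) s, d2', hB₂]; exact b2 s
      have rI3 : ∀ s, |iteratedDeriv 3 Ir s| ≤ B₃ := fun s => by
        rw [← norm_iteratedDeriv_ofReal_comp hIrC s, d3', hB₃]; exact b3 s
      -- far in TIME every jet of `Ir` vanishes (locally `Ir ≡ 0`)
      have hfar : ∀ s, ¬ |k₀ + s * h₀| ≤ klScale e₀ n → ∀ j ≤ 3, iteratedDeriv j Ir s = 0 := by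
        intro s hs j _
        rw [not_le] at hs
        have hcont : Continuous fun s : ℝ => k₀ + s * h₀ := hlinC.continuous
        have hopen : ∀ᶠ s' in 𝓝 s, klScale e₀ n < |k₀ + s' * h₀| :=
          (continuous_abs.comp hcont).continuousAt.eventually (lt_mem_nhds hs)
        have hev : Ir =ᶠ[𝓝 s] fun _ => (0 : ℝ) := by
          filter_upwards [hopen] with s' hs'
          have h1 : klScale e₀ n ^ 2 < (k₀ + s' * h₀) ^ 2 := by
            have := sq_lt_sq' (by linarith [abs_nonneg (k₀ + s' * h₀)]) hs'
            rw [sq_abs] at this; exact this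
          have z1 := scaleProfile_iteratedDeriv_eq_zero he n 0 (u := (k₀ + s' * h₀) ^ 2 + (e k - ν k) ^ 2) (by nlinarith [sq_nonneg (e k - ν k)])
          have z2 := scaleProfile_iteratedDeriv_eq_zero he n 0 (u := (k₀ + s' * h₀) ^ 2 + e k ^ 2) (by nlinarith [sq_nonneg (e k)])
          rw [iteratedDeriv_zero] at z1 z2
          simp only [hIr, hGdef] at z1 z2 ⊢
          rw [z1, z2]; ring
        rw [(hev.iteratedDeriv j).eq_of_nhds, iteratedDeriv_const]
        simp
      exact abs_iteratedDeriv_mul_le_of_local hIrC hQlC (fun _ => True) (fun s => |k₀ + s * h₀| ≤ klScale e₀ n)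
        hB0 hB1 hB2 hB3 hq₀0 hq₁0 hq₂0 hq₃0 rI0 rI1 rI2 rI3 (fun s _ _ => hq₀ _ k)
        (fun s _ hB => by have h := hq₁ k₀ k s hksq hek hB; rwa [← iteratedDeriv_one] at h) (fun s _ hB => hq₂ k₀ k s hksq hek hB)
        (fun s _ hB => hq₃ k₀ k s hksq hek hB) hfar s trivial
    · -- far in SPACE: the increment vanishes on the whole time line
      have hzero : (fun s => Ir s * Ql s) = fun _ => (0 : ℝ) := by
        funext s
        rw [not_le] at hek
        have h2 : klScale e₀ n < |e k - ν k| := by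
          have := abs_sub_abs_le_abs_sub (e k) (ν k); linarith [hP₀ k]
        have sq1 : klScale e₀ n ^ 2 < (k₀ + s * h₀) ^ 2 + e k ^ 2 := by
          have : klScale e₀ n ^ 2 < |e k| ^ 2 := by gcongr; linarith
          rw [sq_abs] at this; nlinarith [sq_nonneg (k₀ + s * h₀)]
        have sq2 : klScale e₀ n ^ 2 < (k₀ + s * h₀) ^ 2 + (e k - ν k) ^ 2 := by
          have : klScale e₀ n ^ 2 < |e k - ν k| ^ 2 := by gcongr
          rw [sq_abs] at this; nlinarith [sq_nonneg (k₀ + s * h₀)]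
        have z1 := scaleProfile_iteratedDeriv_eq_zero he n 0 sq2
        have z2 := scaleProfile_iteratedDeriv_eq_zero he n 0 sq1
        rw [iteratedDeriv_zero] at z1 z2
        simp only [hIr, hGdef] at z1 z2 ⊢
        rw [z1, z2]; ring
      rw [hzero]
      refine ⟨?_, ?_, ?_⟩ <;> simp <;> positivity
  have hK : ∀ (N : ℕ) (K : ℝ), N ≤ 3 → (∀ s, |iteratedDeriv N (fun s => Ir s * Ql s) s| ≤ K) →
      ∀ s ∈ Set.Icc (0 : ℝ) N, ‖iteratedDeriv N (fun s : ℝ => Φ (((k₀, k) : ℝ × (Fin 2 → ℝ)) + s • ((h₀, 0) : ℝ × (Fin 2 → ℝ)))) s‖ ≤ K := by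
    intro N K hN hKb s _
    rw [hline, norm_iteratedDeriv_ofReal_comp (hreal.of_le (by exact_mod_cast hN))]
    exact hKb s
  refine ⟨?_, ?_, ?_⟩
  · have h := norm_fwdDiff_iter_time_apply_le Φ a₀ h₀ hx 1 Gs hGs (hsupp 1 (by norm_num)) q (hC.of_le (by norm_num))
      (hK 1 _ (by norm_num) fun s => (hmain s).1)
    rwa [Function.iterate_one] at h
  · exact norm_fwdDiff_iter_time_apply_le Φ a₀ h₀ hx 2 Gs hGs (hsupp 2 (by norm_num)) q (hC.of_le (by norm_num))
      (hK 2 _ (by norm_num) fun s => (hmain s).2.1)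
  · exact norm_fwdDiff_iter_time_apply_le Φ a₀ h₀ hx 3 Gs hGs (hsupp 3 le_rfl) q hC (hK 3 _ le_rfl fun s => (hmain s).2.2)

end SampledTime

end Summit.HubbardSuperconductivity.HubbardSuperconductivity.Theorems.TorusFourierL2

end
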